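import Literature.Probability.LatticeModels.PoissonDelaunayIsing
import Literature.Probability.LatticeModels.GriffithsMonotonicity
import Literature.Analysis.FunctionSpaces.PoissonMappingHomeomorph
import Literature.Analysis.FunctionSpaces.PoissonDistinctValues
import Literature.Analysis.FunctionSpaces.PoissonPointProcessExistence
import Mathlib.MeasureTheory.Measure.Lebesgue.EqHaar
import HarnessLib

/-!
# Poisson–Delaunay Ising correlators: transport along graph isomorphisms and similarities

Topic `Probability/LatticeModels`; theorem-only companion of `PoissonDelaunayIsing.lean`
(definitions `finVolExpect`, `plusMonomialExpect`, `quenchedCorr`, `pdCorr`), written for the crux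
`DeviceWeylUniversality` of route `CriticalPhenomena/Ising3DConformalLimit/ConformalPoissonDevice`
(stub U_even, ℤ³ ↔ flat Poisson–Delaunay universality: "intensity `N` = lattice spacing `N^{-1/3}`").

* `isingExpect_fixed_iso`, `isingExpect_plus_iso` — transport of finite-volume fixed/plus-boundary
  Ising expectations along a graph ISOMORPHISM `φ : G ≃g G'` between locally finite graphs on
  possibly DIFFERENT vertex types (the tree's `isingExpect_fixed_relabel` is the automorphism case):
  `⟨F⟩^{+}_{φ(Λ);β,h} = ⟨F ∘ φ_*⟩^{+}_{Λ;β,h}` with `φ_* σ = σ ∘ φ⁻¹` (Friedli–Velenik 2017, §3.1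
  eq. (3.8): reindex the Boltzmann sum).
* `finVolExpect_mapHomeomorph`, `plusMonomialExpect_mapHomeomorph`, `quenchedCorr_mapHomeomorph` —
  for a homeomorphism `e` of a proper metric space scaling all distances by `R > 0` (a similarity),
  the quenched Poisson–Delaunay objects of the image configuration `e(ω)` at the image vertices /
  image marked points equal those of `ω` (the Delaunay graph is similarity-equivariant,
  `delaunayGraphIso`; nearest vertices correspond as soon as they are unique).
* `pdCorr_smul_addHaar`, `pdCorr_natCast_smul_addHaar` — the SCALING LAW
  `pdCorr ((a^d t) • μ) β n x = pdCorr (t • μ) β n (a • x)` ("intensity `N` = lattice spacing `N^{-1/d}`").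

No definitions, no named facts.
-/

noncomputable section

open MeasureTheory Finset Set Metric Function
open Literature.Analysis.FunctionSpaces

namespace Literature.Probability.LatticeModels

/-! ### Transport of fixed-boundary expectations along graph isomorphisms -/

section IsoTransport

variable {V V' : Type*} {G : SimpleGraph V} {G' : SimpleGraph V'}
  [DecidableEq V] [DecidableEq V'] [G.LocallyFinite] [G'.LocallyFinite]

omit [DecidableEq V] [DecidableEq V'] [G.LocallyFinite] [G'.LocallyFinite] in
/-- The spin at `φ x` of a configuration on `V'` is the spin at `x` of its pull-back `σ' ∘ φ`.
[folklore] -/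
theorem spinAt_comp_iso (φ : G ≃g G') (σ' : SpinConfig V') (x : V) :
    spinAt (φ x) σ' = spinAt x (σ' ∘ φ) := rfl

/-- The edges touching the image volume are the images of the edges touching the volume,
`ℰ^b_{φ(Λ)} = φ(ℰ^b_Λ)`, for a graph isomorphism `φ : G ≃g G'` (Friedli–Velenik 2017, §3.1; the
automorphism case is the tree's `edgesTouching_map_iso`). [cite: FriedliVelenik2017, §3.1] -/
theorem edgesTouching_map_graphIso (φ : G ≃g G') (Λ : Finset V) :
    edgesTouching G' (Λ.map φ.toEquiv.toEmbedding) =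
      (edgesTouching G Λ).map ⟨Sym2.map φ, Sym2.map.injective φ.injective⟩ := by
  ext e
  rw [mem_edgesTouching_iff, Finset.mem_map]
  simp only [Function.Embedding.coeFn_mk]
  induction e using Sym2.ind with
  | _ a b =>
    constructor
    · rintro ⟨hadj, x, hx, hxe⟩
      rw [Finset.mem_map_equiv] at hx
      have hadj' : G.Adj (φ.symm a) (φ.symm b) :=
        (φ.symm.map_adj_iff).2 ((SimpleGraph.mem_edgeSet _).1 hadj)
      refine ⟨s(φ.symm a, φ.symm b), ?_, ?_⟩
      · rw [mem_edgesTouching_iff]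
        refine ⟨(SimpleGraph.mem_edgeSet _).2 hadj', φ.toEquiv.symm x, hx, ?_⟩
        rcases Sym2.mem_iff.1 hxe with rfl | rfl
        exacts [Sym2.mem_mk_left _ _, Sym2.mem_mk_right _ _]
      · rw [Sym2.map_mk, RelIso.apply_symm_apply, RelIso.apply_symm_apply]
    · rintro ⟨e₀, he₀, he⟩
      induction e₀ using Sym2.ind with
      | _ a₀ b₀ =>
        rw [mem_edgesTouching_iff] at he₀
        obtain ⟨hadj₀, x₀, hx₀, hx₀e⟩ := he₀
        have hadj' : G'.Adj (φ a₀) (φ b₀) :=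
          (φ.map_adj_iff).2 ((SimpleGraph.mem_edgeSet _).1 hadj₀)
        rw [Sym2.map_mk] at he
        rw [← he]
        refine ⟨(SimpleGraph.mem_edgeSet _).2 hadj', φ x₀, ?_, ?_⟩
        · rw [Finset.mem_map_equiv]
          show φ.toEquiv.symm (φ x₀) ∈ Λ
          rw [show φ.toEquiv.symm (φ x₀) = x₀ from φ.toEquiv.symm_apply_apply x₀]
          exact hx₀
        · rcases Sym2.mem_iff.1 hx₀e with rfl | rfl
          exacts [Sym2.mem_mk_left _ _, Sym2.mem_mk_right _ _]

/-- **The fixed-boundary Hamiltonian is transported along a graph isomorphism**: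
`ℋ_{φ(Λ);h}(σ') = ℋ_{Λ;h}(σ' ∘ φ)` (the frozen configuration does not enter the fixed-boundary
Hamiltonian, only the evaluated configuration; Friedli–Velenik 2017, §3.1, eq. (3.6)).
[cite: FriedliVelenik2017, §3.1] -/
theorem isingHamiltonian_fixed_iso (φ : G ≃g G') (Λ : Finset V) (h : ℝ) (η : SpinConfig V)
    (η' : SpinConfig V') (σ' : SpinConfig V') :
    isingHamiltonian G' (Λ.map φ.toEquiv.toEmbedding) h (.fixed η') σ' =
      isingHamiltonian G Λ h (.fixed η) (σ' ∘ φ) := by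
  have h1 : ∑ e ∈ (edgesTouching G Λ).map ⟨Sym2.map φ, Sym2.map.injective φ.injective⟩,
      bondSpin σ' e = ∑ e ∈ edgesTouching G Λ, bondSpin (σ' ∘ φ) e := by
    simp only [Finset.sum_map, Function.Embedding.coeFn_mk]
    refine Finset.sum_congr rfl fun e _ => ?_
    induction e using Sym2.ind with
    | _ a b => rw [Sym2.map_mk, bondSpin_mk, bondSpin_mk]; rfl
  have h2 : ∑ x ∈ Λ.map φ.toEquiv.toEmbedding, spinAt x σ' = ∑ x ∈ Λ, spinAt x (σ' ∘ φ) := by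
    simp only [Finset.sum_map, Equiv.coe_toEmbedding]
    rfl
  simp only [isingHamiltonian, interactionEdges_fixed]
  rw [edgesTouching_map_graphIso, h1, h2]

omit [DecidableEq V] [DecidableEq V'] [G.LocallyFinite] [G'.LocallyFinite] in
/-- Pulling back configurations along the inverse isomorphism is measurable. [folklore] -/
theorem measurable_comp_isoSymm (φ : G ≃g G') :
    Measurable fun σ : SpinConfig V => (σ ∘ φ.symm : SpinConfig V') :=
  measurable_pi_lambda _ fun y => measurable_pi_apply (φ.symm y)

/-- **Transport of fixed-boundary expectations along a graph isomorphism** `φ : G ≃g G'` between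
locally finite graphs on possibly different vertex types:
`⟨F⟩^{η ∘ φ⁻¹}_{φ(Λ);β,h} = ⟨σ ↦ F (σ ∘ φ⁻¹)⟩^{η}_{Λ;β,h}` for measurable `F` (reindex the
Boltzmann sum by `τ ↦ τ ∘ φ⁻¹`; Friedli–Velenik 2017, §3.1, eq. (3.8)). [cite: FriedliVelenik2017, §3.1] -/
theorem isingExpect_fixed_iso (φ : G ≃g G') (Λ : Finset V) (β h : ℝ) (η : SpinConfig V)
    {F : SpinConfig V' → ℝ} (hF : Measurable F) :
    isingExpect G' (Λ.map φ.toEquiv.toEmbedding) β h (.fixed (η ∘ φ.symm)) F =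
      isingExpect G Λ β h (.fixed η) (fun σ => F (σ ∘ φ.symm)) := by
  set Λ' := Λ.map φ.toEquiv.toEmbedding with hΛ'
  have hmem : ∀ {y : V'}, y ∈ Λ' → φ.toEquiv.symm y ∈ Λ := fun hy => by
    rwa [hΛ', Finset.mem_map_equiv] at hy
  have hmem' : ∀ {x : V}, x ∈ Λ → φ.toEquiv x ∈ Λ' := fun {x} hx => by
    rwa [hΛ', Finset.mem_map_equiv, Equiv.symm_apply_apply]
  let e : (Λ → ℤˣ) ≃ (Λ' → ℤˣ) :=
    { toFun := fun τ y => τ ⟨φ.toEquiv.symm y.1, hmem y.2⟩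
      invFun := fun τ' x => τ' ⟨φ.toEquiv x.1, hmem' x.2⟩
      left_inv := fun τ => funext fun x => by
        simp only; congr 1; exact Subtype.ext (φ.toEquiv.symm_apply_apply x.1)
      right_inv := fun τ' => funext fun y => by
        simp only; congr 1; exact Subtype.ext (φ.toEquiv.apply_symm_apply y.1) }
  have hglue : ∀ τ : Λ → ℤˣ,
      glue Λ' (e τ) (.fixed (η ∘ φ.symm)) = glue Λ τ (.fixed η) ∘ φ.symm := by
    intro τ
    funext y
    change glue Λ' (e τ) _ y = glue Λ τ (.fixed η) (φ.toEquiv.symm y)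
    by_cases hy : y ∈ Λ'
    · rw [glue_apply_of_mem _ _ _ hy, glue_apply_of_mem _ _ _ (hmem hy)]
      rfl
    · have hy' : φ.toEquiv.symm y ∉ Λ := fun h' => hy (by simpa using hmem' h')
      rw [glue_apply_of_notMem _ _ _ hy, glue_apply_of_notMem _ _ _ hy',
        BoundaryCondition.outside_fixed, BoundaryCondition.outside_fixed]
      rfl
  have hcomp : ∀ g : SpinConfig V, (g ∘ φ.symm) ∘ φ = g := fun g =>
    funext fun x => by simp
  have hw : ∀ τ : Λ → ℤˣ, isingWeight G' Λ' β h (.fixed (η ∘ φ.symm)) (e τ) =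
      isingWeight G Λ β h (.fixed η) τ := by
    intro τ
    rw [isingWeight, isingWeight, hglue, hΛ', isingHamiltonian_fixed_iso φ Λ h η, hcomp]
  have hFm : Measurable fun σ : SpinConfig V => F (σ ∘ φ.symm) :=
    hF.comp (measurable_comp_isoSymm φ)
  rw [isingExpect_eq_sum_div _ _ _ _ β hF, isingExpect_eq_sum_div _ _ _ _ β hFm,
    isingPartitionFunction, isingPartitionFunction, ← Equiv.sum_comp e, ← Equiv.sum_comp e]
  simp only [hw, hglue]

/-- **Transport of plus-boundary expectations along a graph isomorphism**:
`⟨F⟩^{+}_{φ(Λ);β,h} = ⟨σ ↦ F (σ ∘ φ⁻¹)⟩^{+}_{Λ;β,h}` (the constant configuration `+1` pulls back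
to `+1`). [cite: FriedliVelenik2017, §3.1] -/
theorem isingExpect_plus_iso (φ : G ≃g G') (Λ : Finset V) (β h : ℝ)
    {F : SpinConfig V' → ℝ} (hF : Measurable F) :
    isingExpect G' (Λ.map φ.toEquiv.toEmbedding) β h .plus F =
      isingExpect G Λ β h .plus (fun σ => F (σ ∘ φ.symm)) := by
  have h1 : (BoundaryCondition.plus : BoundaryCondition V') =
      .fixed ((1 : SpinConfig V) ∘ φ.symm) := rfl
  rw [h1]
  exact isingExpect_fixed_iso φ Λ β h 1 hF

end IsoTransport

/-! ### Transport of the quenched Poisson–Delaunay objects along similarities -/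

section Similarity

variable {E E' : Type*} [MetricSpace E] [MetricSpace E']

/-- Local finiteness of the Delaunay graph is transported along the similarity. [folklore] -/
theorem forall_finite_neighborSet_iff (e : E ≃ₜ E') {R : ℝ} (hR : 0 < R)
    (he : ∀ x y, dist (e x) (e y) = R * dist x y) (ω : PointConfig E) :
    (∀ v, ((delaunayGraph ((ω.mapHomeomorph e : PointConfig E') : Set E')).neighborSet v).Finite) ↔
      ∀ v, ((delaunayGraph (ω : Set E)).neighborSet v).Finite := by
  set φ := delaunayGraphIso e hR he e.bijective
  constructor
  · intro h v
    have hfin := h (φ v)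
    rw [← Set.finite_coe_iff] at hfin ⊢
    exact @Finite.of_equiv _ _ hfin (φ.mapNeighborSet v).symm
  · intro h v'
    have hfin := h (φ.symm v')
    rw [← Set.finite_coe_iff] at hfin ⊢
    have := @Finite.of_equiv _ _ hfin (φ.mapNeighborSet (φ.symm v'))
    rwa [RelIso.apply_symm_apply] at this

/-- **Transport of the finite-volume plus expectation along a similarity**: the plus expectation of
`F` in the image volume `φ(Λ)` of the image configuration `e(ω)` is the plus expectation of
`σ ↦ F (σ ∘ φ⁻¹)` in `Λ` (`φ` the induced Delaunay isomorphism; the junk branches correspond).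
[cite: FriedliVelenik2017, §3.1] -/
theorem finVolExpect_mapHomeomorph (e : E ≃ₜ E') {R : ℝ} (hR : 0 < R)
    (he : ∀ x y, dist (e x) (e y) = R * dist x y) (ω : PointConfig E) (β : ℝ)
    (Λ : Finset (ω : Set E))
    {F : SpinConfig ((ω.mapHomeomorph e : PointConfig E') : Set E') → ℝ} (hF : Measurable F) :
    finVolExpect (ω.mapHomeomorph e) β
        (Λ.map (delaunayGraphIso e hR he e.bijective).toEquiv.toEmbedding) F =
      finVolExpect ω β Λ (fun σ => F (σ ∘ (delaunayGraphIso e hR he e.bijective).symm)) := by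
  classical
  set φ := delaunayGraphIso e hR he e.bijective
  unfold finVolExpect
  split_ifs with h₁ h₂ h₂
  · letI : (delaunayGraph (ω : Set E)).LocallyFinite := fun v => (h₂ v).fintype
    letI : (delaunayGraph (e '' (ω : Set E))).LocallyFinite := fun v => (h₁ v).fintype
    exact isingExpect_plus_iso φ Λ β 0 hF
  · exact absurd ((forall_finite_neighborSet_iff e hR he ω).1 h₁) h₂
  · exact absurd ((forall_finite_neighborSet_iff e hR he ω).2 h₂) h₁
  · rfl

/-- **Transport of the infinite-volume plus state on spin monomials along a similarity**:
`⟨∏ᵢ σ_{e(vᵢ)}⟩⁺_{e(ω);β} = ⟨∏ᵢ σ_{vᵢ}⟩⁺_{ω;β}` (reindex the infimum over finite volumes by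
`Λ ↦ φ(Λ)`). [cite: FriedliVelenik2017, §3.4 Thm. 3.17 / Exercise 3.12] -/
theorem plusMonomialExpect_mapHomeomorph (e : E ≃ₜ E') {R : ℝ} (hR : 0 < R)
    (he : ∀ x y, dist (e x) (e y) = R * dist x y) (ω : PointConfig E) (β : ℝ) {n : ℕ}
    (v : Fin n → (ω : Set E)) :
    plusMonomialExpect (ω.mapHomeomorph e) β (fun i => delaunayGraphIso e hR he e.bijective (v i)) =
      plusMonomialExpect ω β v := by
  set φ := delaunayGraphIso e hR he e.bijective with hφ
  -- the index sets of the two infima correspond under `Λ ↦ φ(Λ)`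
  let ι : {Λ : Finset (ω : Set E) // ∀ i, v i ∈ Λ} ≃
      {Λ' : Finset ((ω.mapHomeomorph e : PointConfig E') : Set E') // ∀ i, φ (v i) ∈ Λ'} :=
    (Equiv.finsetCongr φ.toEquiv).subtypeEquiv fun Λ => by
      rw [Equiv.finsetCongr_apply]
      refine forall_congr' fun i => ?_
      exact (Finset.mem_map' φ.toEquiv.toEmbedding).symm
  unfold plusMonomialExpect
  refine (Equiv.iInf_congr ι fun Λ => ?_).symm
  show finVolExpect (ω.mapHomeomorph e) β ((Λ.1).map φ.toEquiv.toEmbedding)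
      (spinMonomial fun i => φ (v i)) = finVolExpect ω β Λ.1 (spinMonomial v)
  rw [hφ, finVolExpect_mapHomeomorph e hR he ω β Λ.1 (measurable_spinMonomial _)]
  congr 1
  funext σ
  simp only [spinMonomial]
  refine Finset.prod_congr rfl fun i _ => ?_
  simp only [spinAt, Function.comp_apply, RelIso.symm_apply_apply]

variable [ProperSpace E] [ProperSpace E']

/-- **Nearest vertices correspond along a similarity** as soon as the nearest vertex is unique
(no two sites of `ω` equidistant from `x`): the nearest vertex of `e(ω)` to `e(x)` is the image of
the nearest vertex of `ω` to `x`. [folklore] -/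
theorem nearestVertex_mapHomeomorph (e : E ≃ₜ E') {R : ℝ} (hR : 0 < R)
    (he : ∀ x y, dist (e x) (e y) = R * dist x y) (ω : PointConfig E)
    (hne : (ω : Set E).Nonempty) (hne' : ((ω.mapHomeomorph e : PointConfig E') : Set E').Nonempty)
    {x : E} (hinj : Set.InjOn (fun p => dist x p) (ω : Set E)) :
    nearestVertex (ω.mapHomeomorph e) hne' (e x) =
      delaunayGraphIso e hR he e.bijective (nearestVertex ω hne x) := by
  set q := nearestVertex (ω.mapHomeomorph e) hne' (e x) with hq
  set p := nearestVertex ω hne x with hp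
  -- `q = e p'` for a site `p'` of `ω`, which is also distance-minimising
  have hqmem : (q : E') ∈ e '' (ω : Set E) := q.2
  obtain ⟨p', hp'ω, hp'q⟩ := hqmem
  have hmin' : ∀ z ∈ (ω : Set E), dist x p' ≤ dist x z := by
    intro z hz
    have h1 : dist (e x) (q : E') ≤ dist (e x) (e z) :=
      dist_nearestVertex_le (ω.mapHomeomorph e) hne' (e x) (Set.mem_image_of_mem e hz)
    rw [← hp'q, he, he] at h1
    exact le_of_mul_le_mul_left h1 hR
  have heq : p' = (p : E) :=
    hinj hp'ω p.2 (le_antisymm (hmin' _ p.2) (dist_nearestVertex_le ω hne x hp'ω))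
  exact Subtype.ext (show (q : E') = e (p : E) by rw [← heq]; exact hp'q.symm)

/-- **The quenched `n`-point function is transported along a similarity**: for a configuration in
which each marked point `xᵢ` has a unique nearest site,
`⟨∏ᵢ σ_{p_{e(ω)}(e xᵢ)}⟩⁺_{e(ω);β} = ⟨∏ᵢ σ_{p_ω(xᵢ)}⟩⁺_{ω;β}` (Delaunay graph, nearest-site
read-out and the Gibbs average are similarity-equivariant). [cite: JankeVillanova2002, §II (the model)] -/
theorem quenchedCorr_mapHomeomorph (e : E ≃ₜ E') {R : ℝ} (hR : 0 < R)
    (he : ∀ x y, dist (e x) (e y) = R * dist x y) (ω : PointConfig E) (β : ℝ) {n : ℕ}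
    (x : Fin n → E) (hinj : ∀ i, Set.InjOn (fun p => dist (x i) p) (ω : Set E)) :
    quenchedCorr (ω.mapHomeomorph e) β n (fun i => e (x i)) = quenchedCorr ω β n x := by
  classical
  unfold quenchedCorr
  split_ifs with h₁ h₂ h₂
  · have hv : (fun i => nearestVertex (ω.mapHomeomorph e) h₁ (e (x i))) =
        fun i => delaunayGraphIso e hR he e.bijective (nearestVertex ω h₂ (x i)) :=
      funext fun i => nearestVertex_mapHomeomorph e hR he ω h₂ h₁ (hinj i)
    rw [hv]
    exact plusMonomialExpect_mapHomeomorph e hR he ω β _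
  · exact absurd h₁ (by rw [PointConfig.coe_mapHomeomorph, Set.image_nonempty]; exact h₂)
  · exact absurd h₂ (by rwa [PointConfig.coe_mapHomeomorph, Set.image_nonempty] at h₁)
  · rfl

end Similarity

/-! ### The scaling law of the annealed Poisson–Delaunay correlators -/

section Scaling

open scoped NNReal ENNReal

variable {E : Type*} [NormedAddCommGroup E] [NormedSpace ℝ E] [FiniteDimensional ℝ E]
  [MeasurableSpace E] [BorelSpace E] [Nontrivial E] (μ : Measure E) [μ.IsAddHaarMeasure]

/-- Under a Poisson process whose intensity is a finite multiple of a Haar measure, for a fixed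
point `y` almost surely no two sites are equidistant from `y` (distance spheres are Haar-null;
Mecke's equation, Last–Penrose 2017, Thm 4.1, through the tree's `IsPoissonPointProcess.ae_injOn`).
[cite: LastPenrose2017, Thm 4.1] -/
theorem ae_injOn_dist_of_isPoissonPointProcess (t : ℝ≥0) {P : Measure (PointConfig E)}
    (hP : IsPoissonPointProcess (t • μ) P) (y : E) :
    ∀ᵐ c ∂P, Set.InjOn (fun p => dist y p) ((c : PointConfig E) : Set E) := by
  refine hP.ae_injOn (continuous_const.dist continuous_id).measurable fun r => ?_
  have hsph : (fun p => dist y p) ⁻¹' {r} = Metric.sphere y r := by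
    ext p
    rw [Set.mem_preimage, Set.mem_singleton_iff, Metric.mem_sphere, dist_comm]
  rw [hsph, Measure.smul_apply, Measure.addHaar_sphere μ y r, smul_zero]

/-- A finite multiple of a Haar measure on a nontrivial space is the intensity of a Poisson law, so
`poissonLaw (t • μ)` is a Poisson point process with intensity `t • μ` (Kingman's existence theorem,
tree `existsUnique_isPoissonPointProcess_holds`). [cite: Kingman1993, §2.5] -/
theorem isPoissonPointProcess_poissonLaw_smul_addHaar (t : ℝ≥0) :
    IsPoissonPointProcess (t • μ) (poissonLaw (t • μ)) :=
  isPoissonPointProcess_poissonLaw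
    (existsUnique_isPoissonPointProcess_holds (t • μ) fun x => by
      rw [Measure.smul_apply, measure_singleton, smul_zero]).exists

/-- **Scaling law of the annealed Poisson–Delaunay correlators** ("intensity `a^d` = lattice spacing
`a⁻¹`"): for a Haar measure `μ` on a `d`-dimensional space, `a > 0` and `t ≥ 0`,
`pdCorr ((a^d t) • μ) β n x = pdCorr (t • μ) β n (a • x)`. The dilation `z ↦ a⁻¹ z` maps the Poisson
process of intensity `t • μ` to the one of intensity `a^d t • μ` (Mapping Theorem, Kingman 1993 §2.3,
tree `IsPoissonPointProcess.mapHomeomorph'`, with Rényi uniqueness `unique_holds` to identify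
`poissonLaw`), and the quenched correlator is similarity-equivariant off the null event of distance
ties (`quenchedCorr_mapHomeomorph`, `ae_injOn_dist_of_isPoissonPointProcess`); no measurability of the
quenched correlator is needed (`integral_map_equiv`, `integral_congr_ae`).
[cite: Kingman1993, §2.3 Mapping Theorem, p. 18] -/
theorem pdCorr_smul_addHaar {a : ℝ} (ha : 0 < a) (t : ℝ≥0) (β : ℝ) {n : ℕ} (x : Fin n → E) :
    pdCorr (((a ^ Module.finrank ℝ E).toNNReal * t) • μ) β n x =
      pdCorr (t • μ) β n (fun i => a • x i) := by
  -- the dilation by `a⁻¹`, a similarity of ratio `a⁻¹`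
  have ha' : a⁻¹ ≠ 0 := inv_ne_zero ha.ne'
  set e : E ≃ₜ E := Homeomorph.smulOfNeZero a⁻¹ ha' with he_def
  have he_apply : ∀ z : E, e z = a⁻¹ • z := fun _ => rfl
  have he : ∀ y z : E, dist (e y) (e z) = a⁻¹ * dist y z := fun y z => by
    rw [he_apply, he_apply, dist_smul₀, Real.norm_eq_abs, abs_of_pos (inv_pos.2 ha)]
  -- the image intensity `(t • μ) ∘ e⁻¹ = (a^d t) • μ`
  set t' : ℝ≥0 := (a ^ Module.finrank ℝ E).toNNReal * t with ht'
  have hcoe : ∀ z : E, (fun z : E => a⁻¹ • z) z = e z := fun _ => rfl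
  have hmapμ : μ.map e = ENNReal.ofReal (a ^ Module.finrank ℝ E) • μ := by
    rw [show (⇑e : E → E) = fun z => a⁻¹ • z from funext fun z => (hcoe z).symm,
      Measure.map_addHaar_smul μ ha', inv_pow, inv_inv, abs_of_pos (pow_pos ha _)]
  have hmapν : (t • μ).map e = t' • μ := by
    rw [Measure.map_smul, hmapμ]
    ext s _
    simp only [Measure.smul_apply, ENNReal.smul_def, smul_eq_mul, ht', ENNReal.coe_mul]
    rw [show ((Real.toNNReal (a ^ Module.finrank ℝ E) : ℝ≥0) : ℝ≥0∞) =
      ENNReal.ofReal (a ^ Module.finrank ℝ E) from rfl]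
    ring
  -- the Poisson laws correspond (Mapping Theorem + Rényi uniqueness)
  have hP := isPoissonPointProcess_poissonLaw_smul_addHaar μ t
  have hPe : IsPoissonPointProcess (t' • μ)
      ((poissonLaw (t • μ)).map (PointConfig.mapHomeomorph e)) := by
    have := hP.mapHomeomorph' e
    rwa [hmapν] at this
  have hP' := isPoissonPointProcess_poissonLaw_smul_addHaar μ t'
  have hlaw : poissonLaw (t' • μ) = (poissonLaw (t • μ)).map (PointConfig.mapHomeomorph e) :=
    IsPoissonPointProcess.unique_holds hP' hPe
  -- transport the (possibly junk) Bochner integral along the measurable equivalence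
  rw [pdCorr_eq, pdCorr_eq, hlaw, ← PointConfig.coe_mapHomeomorphEquiv, integral_map_equiv]
  refine integral_congr_ae ?_
  have hae : ∀ᵐ ω ∂(poissonLaw (t • μ)),
      ∀ i, Set.InjOn (fun p => dist (a • x i) p) ((ω : PointConfig E) : Set E) :=
    ae_all_iff.2 fun i => ae_injOn_dist_of_isPoissonPointProcess μ t hP (a • x i)
  filter_upwards [hae] with ω hω
  have hx : (fun i => e (a • x i)) = x := funext fun i => by
    rw [he_apply, smul_smul, inv_mul_cancel₀ ha.ne', one_smul]
  rw [PointConfig.coe_mapHomeomorphEquiv]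
  conv_lhs => rw [← hx]
  exact quenchedCorr_mapHomeomorph e (inv_pos.2 ha) he ω β (fun i => a • x i) hω

/-- **Intensity `N` is lattice spacing `N^{-1/d}`**: for `N ≥ 1`,
`pdCorr (N • μ) β n x = pdCorr μ β n (N^{1/d} • x)` (`d = dim E`; the case used by route
`ConformalPoissonDevice` is `μ =` Lebesgue measure on `ℝ³`, `pdCorr (N • vol) β n x = pdCorr vol β n (N^{1/3} x)`).
[cite: Kingman1993, §2.3 Mapping Theorem, p. 18] -/
theorem pdCorr_natCast_smul_addHaar {N : ℕ} (hN : N ≠ 0) (β : ℝ) {n : ℕ} (x : Fin n → E) :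
    pdCorr ((N : ℝ≥0∞) • μ) β n x =
      pdCorr μ β n (fun i => ((N : ℝ) ^ (Module.finrank ℝ E : ℝ)⁻¹) • x i) := by
  have hNpos : (0 : ℝ) < N := Nat.cast_pos.2 (Nat.pos_of_ne_zero hN)
  have h := pdCorr_smul_addHaar μ (Real.rpow_pos_of_pos hNpos (Module.finrank ℝ E : ℝ)⁻¹) 1 β x
  rwa [Real.rpow_inv_natCast_pow hNpos.le Module.finrank_pos.ne', Real.toNNReal_natCast, mul_one,
    one_smul] at h

end Scaling

end Literature.Probability.LatticeModels

end
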